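import Mathlib.Analysis.InnerProductSpace.PiL2
import Mathlib.Tactic.Module

/-!
# FrustratedLawDichotomy · residual crux `AperiodicFrustratedLawGap` (stmt-AtomisticToContinuum-27623) — the LJ PAIR-FORCE TAYLOR REMAINDER (T1b, host-independent)
# (hdef side, class A: the remainder `f` of the adjoint certificate NODE-9 `…AdjointCertificate`; decomp-a2c lens-5 g111 NODE-10; critic r1726 / r1731 order)

The Lennard–Jones pair force of the tree (`…NashForceBalance`: summand `((dist p q)⁻¹ ^ 8 - (dist p q)⁻¹ ^ 14) • (p - q)`) is, as a function of the bond
vector `x = p - q`, `g x = ψ(‖x‖²) • x` with the RATIONAL factor `ψ t = t⁻¹ ^ 4 - t⁻¹ ^ 7` of the squared length — no square roots.  Its linearisation at `x` in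
the direction `δ` is `ψ(‖x‖²) • δ + (2⟪x, δ⟫ · ψ′(‖x‖²)) • x`, `ψ′ t = -4 t⁻¹ ^ 5 + 7 t⁻¹ ^ 8`.  This file books the second-order remainder EXACTLY and bounds it:

* `inv_pow_four_taylor`, `inv_pow_seven_taylor` — the exact identities `t₁⁻¹^k - t₀⁻¹^k + k t₀⁻¹^(k+1) (t₁ - t₀) = (t₁ - t₀)² · Q_k(t₀, t₁)` (k = 4, 7) with `Q_k` an explicit
  positive combination of inverse powers (second divided difference), and `Q_k ≤ k(k+1)/2 · ρ⁻¹^(k+2)` for `ρ ≤ t₀, t₁` (`inv_pow_four_taylor_le`, `…seven…`);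
* `psi_taylor_abs_le` — `|ψ t₁ - ψ t₀ - ψ′ t₀ (t₁ - t₀)| ≤ max (10 ρ⁻¹^6) (28 ρ⁻¹^9) · (t₁ - t₀)²` (two-sided form `psi_taylor_le` / `le_psi_taylor` keeps the signs);
* `force_remainder_eq` — the exact vector identity `g (x+δ) - g x - L x δ = (ψ₁ - ψ₀ - ψ′₀ Δ) • (x + δ) + ψ′₀ • (‖δ‖² • x + Δ • δ)`, `Δ = ‖x + δ‖² - ‖x‖² = 2⟪x,δ⟫ + ‖δ‖²`,
  stated for ARBITRARY scalars (so a per-cell certificate may substitute interval values);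
* `norm_force_remainder_le` — the assembled bound `‖g (x+δ) - g x - L x δ‖ ≤ max (10 ρ⁻¹^6) (28 ρ⁻¹^9) · (2‖x‖‖δ‖ + ‖δ‖²)² · ‖x + δ‖ + |ψ′(‖x‖²)| · (‖δ‖² ‖x‖ +
  (2‖x‖‖δ‖ + ‖δ‖²) ‖δ‖)` whenever `0 < ρ ≤ ‖x‖², ‖x + δ‖²` — quadratic in `‖δ‖`, i.e. the `fmax = C(cell) · (2τ)²` column of T2 with an explicit `C`.

DEF-FREE (all functions written out); Mathlib only; general real inner-product space. [folklore: Taylor remainder of a rational radial vector field via divided differences]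
-/

namespace Summit.AtomisticToContinuum.Crystallization.Theorems.FrustratedLawDichotomyForceRemainder

open RealInnerProductSpace

/-! ## Scalar part: exact second-order Taylor identities for `t⁻¹ ^ 4` and `t⁻¹ ^ 7` -/

/-- Inverse powers are antitone in the base on the positive reals (the instance used below). [folklore] -/
theorem inv_pow_le_inv_pow {ρ t : ℝ} (hρ : 0 < ρ) (h : ρ ≤ t) (n : ℕ) : t⁻¹ ^ n ≤ ρ⁻¹ ^ n :=
  pow_le_pow_left₀ (inv_nonneg.mpr (hρ.le.trans h)) (inv_anti₀ hρ h) n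

/-- exact: `t₁⁻⁴ - t₀⁻⁴ + 4 t₀⁻⁵ (t₁ - t₀) = (t₁ - t₀)² Q₄`. [folklore] -/
theorem inv_pow_four_taylor {t₀ t₁ : ℝ} (h₀ : t₀ ≠ 0) (h₁ : t₁ ≠ 0) :
    t₁⁻¹ ^ 4 - t₀⁻¹ ^ 4 + 4 * t₀⁻¹ ^ 5 * (t₁ - t₀)
      = (t₁ - t₀) ^ 2 * (t₀⁻¹ ^ 2 * t₁⁻¹ ^ 4 + 2 * (t₀⁻¹ ^ 3 * t₁⁻¹ ^ 3) + 3 * (t₀⁻¹ ^ 4 * t₁⁻¹ ^ 2) + 4 * (t₀⁻¹ ^ 5 * t₁⁻¹)) := by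
  field_simp
  ring

/-- exact: `t₁⁻⁷ - t₀⁻⁷ + 7 t₀⁻⁸ (t₁ - t₀) = (t₁ - t₀)² Q₇`. [folklore] -/
theorem inv_pow_seven_taylor {t₀ t₁ : ℝ} (h₀ : t₀ ≠ 0) (h₁ : t₁ ≠ 0) :
    t₁⁻¹ ^ 7 - t₀⁻¹ ^ 7 + 7 * t₀⁻¹ ^ 8 * (t₁ - t₀)
      = (t₁ - t₀) ^ 2 * (t₀⁻¹ ^ 2 * t₁⁻¹ ^ 7 + 2 * (t₀⁻¹ ^ 3 * t₁⁻¹ ^ 6) + 3 * (t₀⁻¹ ^ 4 * t₁⁻¹ ^ 5) + 4 * (t₀⁻¹ ^ 5 * t₁⁻¹ ^ 4)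
          + 5 * (t₀⁻¹ ^ 6 * t₁⁻¹ ^ 3) + 6 * (t₀⁻¹ ^ 7 * t₁⁻¹ ^ 2) + 7 * (t₀⁻¹ ^ 8 * t₁⁻¹)) := by
  field_simp
  ring

/-- `0 ≤ Q₄ ≤ 10 ρ⁻⁶` on `ρ ≤ t₀, t₁`. [folklore] -/
theorem inv_pow_four_taylor_le {ρ t₀ t₁ : ℝ} (hρ : 0 < ρ) (h₀ : ρ ≤ t₀) (h₁ : ρ ≤ t₁) :
    0 ≤ t₀⁻¹ ^ 2 * t₁⁻¹ ^ 4 + 2 * (t₀⁻¹ ^ 3 * t₁⁻¹ ^ 3) + 3 * (t₀⁻¹ ^ 4 * t₁⁻¹ ^ 2) + 4 * (t₀⁻¹ ^ 5 * t₁⁻¹) ∧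
    t₀⁻¹ ^ 2 * t₁⁻¹ ^ 4 + 2 * (t₀⁻¹ ^ 3 * t₁⁻¹ ^ 3) + 3 * (t₀⁻¹ ^ 4 * t₁⁻¹ ^ 2) + 4 * (t₀⁻¹ ^ 5 * t₁⁻¹) ≤ 10 * ρ⁻¹ ^ 6 := by
  have a0 : 0 ≤ t₀⁻¹ := inv_nonneg.mpr (hρ.le.trans h₀)
  have b0 : 0 ≤ t₁⁻¹ := inv_nonneg.mpr (hρ.le.trans h₁)
  have ha := fun n => inv_pow_le_inv_pow hρ h₀ n
  have hb := fun n => inv_pow_le_inv_pow hρ h₁ n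
  have key : ∀ m n : ℕ, 0 ≤ t₀⁻¹ ^ m * t₁⁻¹ ^ n ∧ t₀⁻¹ ^ m * t₁⁻¹ ^ n ≤ ρ⁻¹ ^ (m + n) := fun m n =>
    ⟨mul_nonneg (pow_nonneg a0 m) (pow_nonneg b0 n),
     by rw [pow_add]; exact mul_le_mul (ha m) (hb n) (pow_nonneg b0 n) (pow_nonneg (inv_nonneg.mpr hρ.le) m)⟩
  have e1 := key 2 4; have e2 := key 3 3; have e3 := key 4 2; have e4 := key 5 1
  simp only [pow_one] at e4
  constructor <;> nlinarith [e1.1, e1.2, e2.1, e2.2, e3.1, e3.2, e4.1, e4.2]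

/-- `0 ≤ Q₇ ≤ 28 ρ⁻⁹` on `ρ ≤ t₀, t₁`. [folklore] -/
theorem inv_pow_seven_taylor_le {ρ t₀ t₁ : ℝ} (hρ : 0 < ρ) (h₀ : ρ ≤ t₀) (h₁ : ρ ≤ t₁) :
    0 ≤ t₀⁻¹ ^ 2 * t₁⁻¹ ^ 7 + 2 * (t₀⁻¹ ^ 3 * t₁⁻¹ ^ 6) + 3 * (t₀⁻¹ ^ 4 * t₁⁻¹ ^ 5) + 4 * (t₀⁻¹ ^ 5 * t₁⁻¹ ^ 4)
          + 5 * (t₀⁻¹ ^ 6 * t₁⁻¹ ^ 3) + 6 * (t₀⁻¹ ^ 7 * t₁⁻¹ ^ 2) + 7 * (t₀⁻¹ ^ 8 * t₁⁻¹) ∧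
    t₀⁻¹ ^ 2 * t₁⁻¹ ^ 7 + 2 * (t₀⁻¹ ^ 3 * t₁⁻¹ ^ 6) + 3 * (t₀⁻¹ ^ 4 * t₁⁻¹ ^ 5) + 4 * (t₀⁻¹ ^ 5 * t₁⁻¹ ^ 4)
          + 5 * (t₀⁻¹ ^ 6 * t₁⁻¹ ^ 3) + 6 * (t₀⁻¹ ^ 7 * t₁⁻¹ ^ 2) + 7 * (t₀⁻¹ ^ 8 * t₁⁻¹) ≤ 28 * ρ⁻¹ ^ 9 := by
  have a0 : 0 ≤ t₀⁻¹ := inv_nonneg.mpr (hρ.le.trans h₀)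
  have b0 : 0 ≤ t₁⁻¹ := inv_nonneg.mpr (hρ.le.trans h₁)
  have ha := fun n => inv_pow_le_inv_pow hρ h₀ n
  have hb := fun n => inv_pow_le_inv_pow hρ h₁ n
  have key : ∀ m n : ℕ, 0 ≤ t₀⁻¹ ^ m * t₁⁻¹ ^ n ∧ t₀⁻¹ ^ m * t₁⁻¹ ^ n ≤ ρ⁻¹ ^ (m + n) := fun m n =>
    ⟨mul_nonneg (pow_nonneg a0 m) (pow_nonneg b0 n),
     by rw [pow_add]; exact mul_le_mul (ha m) (hb n) (pow_nonneg b0 n) (pow_nonneg (inv_nonneg.mpr hρ.le) m)⟩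
  have e1 := key 2 7; have e2 := key 3 6; have e3 := key 4 5; have e4 := key 5 4; have e5 := key 6 3; have e6 := key 7 2; have e7 := key 8 1
  simp only [pow_one] at e7
  constructor <;> nlinarith [e1.1, e1.2, e2.1, e2.2, e3.1, e3.2, e4.1, e4.2, e5.1, e5.2, e6.1, e6.2, e7.1, e7.2]

/-- Two-sided Taylor bound for `ψ t = t⁻¹^4 - t⁻¹^7`, `ψ′ t = -4 t⁻¹^5 + 7 t⁻¹^8` (upper side: the repulsive curvature). [folklore] -/
theorem psi_taylor_le {ρ t₀ t₁ : ℝ} (hρ : 0 < ρ) (h₀ : ρ ≤ t₀) (h₁ : ρ ≤ t₁) :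
    (t₁⁻¹ ^ 4 - t₁⁻¹ ^ 7) - (t₀⁻¹ ^ 4 - t₀⁻¹ ^ 7) - (-4 * t₀⁻¹ ^ 5 + 7 * t₀⁻¹ ^ 8) * (t₁ - t₀) ≤ 10 * ρ⁻¹ ^ 6 * (t₁ - t₀) ^ 2 := by
  have ht₀ : t₀ ≠ 0 := (hρ.trans_le h₀).ne'
  have ht₁ : t₁ ≠ 0 := (hρ.trans_le h₁).ne'
  have i4 := inv_pow_four_taylor ht₀ ht₁
  have i7 := inv_pow_seven_taylor ht₀ ht₁
  obtain ⟨q4l, q4u⟩ := inv_pow_four_taylor_le hρ h₀ h₁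
  obtain ⟨q7l, q7u⟩ := inv_pow_seven_taylor_le hρ h₀ h₁
  have hs : 0 ≤ (t₁ - t₀) ^ 2 := sq_nonneg _
  nlinarith [mul_le_mul_of_nonneg_left q4u hs, mul_nonneg hs q7l]

/-- Lower side (the attractive curvature). [folklore] -/
theorem le_psi_taylor {ρ t₀ t₁ : ℝ} (hρ : 0 < ρ) (h₀ : ρ ≤ t₀) (h₁ : ρ ≤ t₁) :
    -(28 * ρ⁻¹ ^ 9 * (t₁ - t₀) ^ 2) ≤ (t₁⁻¹ ^ 4 - t₁⁻¹ ^ 7) - (t₀⁻¹ ^ 4 - t₀⁻¹ ^ 7) - (-4 * t₀⁻¹ ^ 5 + 7 * t₀⁻¹ ^ 8) * (t₁ - t₀) := by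
  have ht₀ : t₀ ≠ 0 := (hρ.trans_le h₀).ne'
  have ht₁ : t₁ ≠ 0 := (hρ.trans_le h₁).ne'
  have i4 := inv_pow_four_taylor ht₀ ht₁
  have i7 := inv_pow_seven_taylor ht₀ ht₁
  obtain ⟨q4l, q4u⟩ := inv_pow_four_taylor_le hρ h₀ h₁
  obtain ⟨q7l, q7u⟩ := inv_pow_seven_taylor_le hρ h₀ h₁
  have hs : 0 ≤ (t₁ - t₀) ^ 2 := sq_nonneg _
  nlinarith [mul_le_mul_of_nonneg_left q7u hs, mul_nonneg hs q4l]

/-- `|ψ t₁ - ψ t₀ - ψ′ t₀ (t₁ - t₀)| ≤ max (10 ρ⁻⁶) (28 ρ⁻⁹) (t₁ - t₀)²`. [folklore] -/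
theorem psi_taylor_abs_le {ρ t₀ t₁ : ℝ} (hρ : 0 < ρ) (h₀ : ρ ≤ t₀) (h₁ : ρ ≤ t₁) :
    |(t₁⁻¹ ^ 4 - t₁⁻¹ ^ 7) - (t₀⁻¹ ^ 4 - t₀⁻¹ ^ 7) - (-4 * t₀⁻¹ ^ 5 + 7 * t₀⁻¹ ^ 8) * (t₁ - t₀)|
      ≤ max (10 * ρ⁻¹ ^ 6) (28 * ρ⁻¹ ^ 9) * (t₁ - t₀) ^ 2 := by
  have hs : 0 ≤ (t₁ - t₀) ^ 2 := sq_nonneg _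
  rw [abs_le]
  constructor
  · have := le_psi_taylor hρ h₀ h₁
    nlinarith [mul_le_mul_of_nonneg_right (le_max_right (10 * ρ⁻¹ ^ 6) (28 * ρ⁻¹ ^ 9)) hs]
  · have := psi_taylor_le hρ h₀ h₁
    nlinarith [mul_le_mul_of_nonneg_right (le_max_left (10 * ρ⁻¹ ^ 6) (28 * ρ⁻¹ ^ 9)) hs]

/-- The pure-displacement reading used by T2: both endpoints of a host bond `n` move by at most `τ`, so the bond vector changes by `δ` with `‖δ‖ ≤ 2τ`; with
`‖n‖ ≥ r₀ > 2τ` the hypotheses `ρ ≤ ‖n‖², ‖n + δ‖²` hold for `ρ = (r₀ - 2τ)²`. [folklore] -/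
theorem sq_le_norm_add_sq_of_le {W : Type*} [NormedAddCommGroup W] (n δ : W) {r₀ η : ℝ} (hr : η < r₀) (hn : r₀ ≤ ‖n‖) (hδ : ‖δ‖ ≤ η) :
    (r₀ - η) ^ 2 ≤ ‖n + δ‖ ^ 2 := by
  have h1 : r₀ - η ≤ ‖n + δ‖ := by
    have := norm_sub_norm_le n (-δ)
    rw [sub_neg_eq_add, norm_neg] at this
    linarith [norm_le_norm_add_norm_sub' n (n + δ), norm_add_sub_cancel_left]
  exact pow_le_pow_left₀ (by linarith) h1 2
  where
  norm_add_sub_cancel_left : ‖n + δ - n‖ = ‖δ‖ := by rw [add_sub_cancel_left]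


/-! ## Vector part: the pair force `g x = ψ(‖x‖²) • x` in a real inner-product space -/

variable {V : Type*} [NormedAddCommGroup V] [InnerProductSpace ℝ V]

/-- Exact remainder identity with ARBITRARY scalars `a = ψ₀`, `b = ψ₁`, `c = ψ′₀`: the force difference minus its linearisation equals the scalar Taylor remainder times
`x + δ` plus the explicit quadratic term `c • (‖δ‖² • x + Δ • δ)`, `Δ = ‖x + δ‖² - ‖x‖²`. [folklore] -/
theorem force_remainder_eq (x δ : V) (a b c : ℝ) :
    b • (x + δ) - a • x - (a • δ + (2 * ⟪x, δ⟫ * c) • x)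
      = (b - a - c * (‖x + δ‖ ^ 2 - ‖x‖ ^ 2)) • (x + δ) + c • (‖δ‖ ^ 2 • x + (‖x + δ‖ ^ 2 - ‖x‖ ^ 2) • δ) := by
  have hΔ : ‖x + δ‖ ^ 2 - ‖x‖ ^ 2 = 2 * ⟪x, δ⟫ + ‖δ‖ ^ 2 := by rw [norm_add_sq_real]; ring
  rw [hΔ]
  module

/-- `|Δ| ≤ 2‖x‖‖δ‖ + ‖δ‖²` for `Δ = ‖x + δ‖² - ‖x‖²`. [folklore] -/
theorem abs_norm_add_sq_sub_le (x δ : V) : |‖x + δ‖ ^ 2 - ‖x‖ ^ 2| ≤ 2 * ‖x‖ * ‖δ‖ + ‖δ‖ ^ 2 := by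
  have hΔ : ‖x + δ‖ ^ 2 - ‖x‖ ^ 2 = 2 * ⟪x, δ⟫ + ‖δ‖ ^ 2 := by rw [norm_add_sq_real]; ring
  rw [hΔ]
  have h := abs_real_inner_le_norm x δ
  calc |2 * ⟪x, δ⟫ + ‖δ‖ ^ 2| ≤ |2 * ⟪x, δ⟫| + |‖δ‖ ^ 2| := abs_add_le _ _
    _ = 2 * |⟪x, δ⟫| + ‖δ‖ ^ 2 := by rw [abs_mul, abs_two, abs_of_nonneg (sq_nonneg ‖δ‖)]
    _ ≤ 2 * ‖x‖ * ‖δ‖ + ‖δ‖ ^ 2 := by nlinarith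

/-- Norm bound of the remainder in terms of the scalar remainder `R = b - a - cΔ` and `|c|` — the form a per-cell certificate consumes (it supplies interval bounds for
`|R|` and `|c|` on the cell's bond lengths). [folklore] -/
theorem norm_force_remainder_le_of_scalars (x δ : V) (a b c : ℝ) :
    ‖b • (x + δ) - a • x - (a • δ + (2 * ⟪x, δ⟫ * c) • x)‖
      ≤ |b - a - c * (‖x + δ‖ ^ 2 - ‖x‖ ^ 2)| * ‖x + δ‖ + |c| * (‖δ‖ ^ 2 * ‖x‖ + (2 * ‖x‖ * ‖δ‖ + ‖δ‖ ^ 2) * ‖δ‖) := by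
  rw [force_remainder_eq]
  have hΔ := abs_norm_add_sq_sub_le x δ
  calc ‖(b - a - c * (‖x + δ‖ ^ 2 - ‖x‖ ^ 2)) • (x + δ) + c • (‖δ‖ ^ 2 • x + (‖x + δ‖ ^ 2 - ‖x‖ ^ 2) • δ)‖
      ≤ ‖(b - a - c * (‖x + δ‖ ^ 2 - ‖x‖ ^ 2)) • (x + δ)‖ + ‖c • (‖δ‖ ^ 2 • x + (‖x + δ‖ ^ 2 - ‖x‖ ^ 2) • δ)‖ := norm_add_le _ _
    _ = |b - a - c * (‖x + δ‖ ^ 2 - ‖x‖ ^ 2)| * ‖x + δ‖ + |c| * ‖‖δ‖ ^ 2 • x + (‖x + δ‖ ^ 2 - ‖x‖ ^ 2) • δ‖ := by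
        rw [norm_smul, norm_smul, Real.norm_eq_abs, Real.norm_eq_abs]
    _ ≤ |b - a - c * (‖x + δ‖ ^ 2 - ‖x‖ ^ 2)| * ‖x + δ‖ + |c| * (‖δ‖ ^ 2 * ‖x‖ + (2 * ‖x‖ * ‖δ‖ + ‖δ‖ ^ 2) * ‖δ‖) := by
        have h1 : ‖‖δ‖ ^ 2 • x + (‖x + δ‖ ^ 2 - ‖x‖ ^ 2) • δ‖ ≤ ‖δ‖ ^ 2 * ‖x‖ + (2 * ‖x‖ * ‖δ‖ + ‖δ‖ ^ 2) * ‖δ‖ := by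
          calc ‖‖δ‖ ^ 2 • x + (‖x + δ‖ ^ 2 - ‖x‖ ^ 2) • δ‖ ≤ ‖‖δ‖ ^ 2 • x‖ + ‖(‖x + δ‖ ^ 2 - ‖x‖ ^ 2) • δ‖ := norm_add_le _ _
            _ = ‖δ‖ ^ 2 * ‖x‖ + |‖x + δ‖ ^ 2 - ‖x‖ ^ 2| * ‖δ‖ := by
                rw [norm_smul, norm_smul, Real.norm_eq_abs, Real.norm_eq_abs, abs_of_nonneg (sq_nonneg _)]
            _ ≤ ‖δ‖ ^ 2 * ‖x‖ + (2 * ‖x‖ * ‖δ‖ + ‖δ‖ ^ 2) * ‖δ‖ := by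
                have := mul_le_mul_of_nonneg_right hΔ (norm_nonneg δ); linarith
        have := mul_le_mul_of_nonneg_left h1 (abs_nonneg c)
        linarith

/-- ★ **LJ pair-force Taylor remainder (T1b).**  For the tree's force `g x = (‖x‖²)⁻¹^4 • x - (‖x‖²)⁻¹^7 • x` written with `ψ`, and its linearisation
`L x δ = ψ(‖x‖²) • δ + (2⟪x,δ⟫ ψ′(‖x‖²)) • x`: if `0 < ρ ≤ ‖x‖²` and `ρ ≤ ‖x + δ‖²` then
`‖g (x+δ) - g x - L x δ‖ ≤ max (10 ρ⁻⁶) (28 ρ⁻⁹) (2‖x‖‖δ‖ + ‖δ‖²)² ‖x + δ‖ + |ψ′(‖x‖²)| (‖δ‖²‖x‖ + (2‖x‖‖δ‖ + ‖δ‖²)‖δ‖)` — quadratic in `‖δ‖`. [folklore] -/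
theorem norm_force_remainder_le (x δ : V) {ρ : ℝ} (hρ : 0 < ρ) (h₀ : ρ ≤ ‖x‖ ^ 2) (h₁ : ρ ≤ ‖x + δ‖ ^ 2) :
    ‖((‖x + δ‖ ^ 2)⁻¹ ^ 4 - (‖x + δ‖ ^ 2)⁻¹ ^ 7) • (x + δ) - ((‖x‖ ^ 2)⁻¹ ^ 4 - (‖x‖ ^ 2)⁻¹ ^ 7) • x
        - (((‖x‖ ^ 2)⁻¹ ^ 4 - (‖x‖ ^ 2)⁻¹ ^ 7) • δ + (2 * ⟪x, δ⟫ * (-4 * (‖x‖ ^ 2)⁻¹ ^ 5 + 7 * (‖x‖ ^ 2)⁻¹ ^ 8)) • x)‖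
      ≤ max (10 * ρ⁻¹ ^ 6) (28 * ρ⁻¹ ^ 9) * (2 * ‖x‖ * ‖δ‖ + ‖δ‖ ^ 2) ^ 2 * ‖x + δ‖
        + |-4 * (‖x‖ ^ 2)⁻¹ ^ 5 + 7 * (‖x‖ ^ 2)⁻¹ ^ 8| * (‖δ‖ ^ 2 * ‖x‖ + (2 * ‖x‖ * ‖δ‖ + ‖δ‖ ^ 2) * ‖δ‖) := by
  refine (norm_force_remainder_le_of_scalars x δ _ _ _).trans ?_
  have hR := psi_taylor_abs_le hρ h₀ h₁
  have hΔ := abs_norm_add_sq_sub_le x δ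
  have hΔ2 : (‖x + δ‖ ^ 2 - ‖x‖ ^ 2) ^ 2 ≤ (2 * ‖x‖ * ‖δ‖ + ‖δ‖ ^ 2) ^ 2 := by
    rw [← sq_abs (‖x + δ‖ ^ 2 - ‖x‖ ^ 2)]
    exact pow_le_pow_left₀ (abs_nonneg _) hΔ 2
  have hM : 0 ≤ max (10 * ρ⁻¹ ^ 6) (28 * ρ⁻¹ ^ 9) :=
    le_max_of_le_left (mul_nonneg (by norm_num) (pow_nonneg (inv_nonneg.mpr hρ.le) 6))
  have h1 : |((‖x + δ‖ ^ 2)⁻¹ ^ 4 - (‖x + δ‖ ^ 2)⁻¹ ^ 7) - ((‖x‖ ^ 2)⁻¹ ^ 4 - (‖x‖ ^ 2)⁻¹ ^ 7)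
      - (-4 * (‖x‖ ^ 2)⁻¹ ^ 5 + 7 * (‖x‖ ^ 2)⁻¹ ^ 8) * (‖x + δ‖ ^ 2 - ‖x‖ ^ 2)| * ‖x + δ‖
      ≤ max (10 * ρ⁻¹ ^ 6) (28 * ρ⁻¹ ^ 9) * (2 * ‖x‖ * ‖δ‖ + ‖δ‖ ^ 2) ^ 2 * ‖x + δ‖ :=
    mul_le_mul_of_nonneg_right (hR.trans (mul_le_mul_of_nonneg_left hΔ2 hM)) (norm_nonneg _)
  linarith

end Summit.AtomisticToContinuum.Crystallization.Theorems.FrustratedLawDichotomyForceRemainder
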